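import Summits.BirchSwinnertonDyer.Rank1Residual.X11b.BDPRouteHalves
import Summits.BirchSwinnertonDyer.Rank1Residual.X11b.BDPRouteManin
import HarnessLib

/-!
# Class X11b, route "BDP + converse-theorem engine + Kolyvagin": the two halves of `BSD(E,p)` at class level (cell `b2b-bsdres`, sub-cell `multr1-p2`, gen 3)

HONEST FRAMING (cell `b2b-bsdres`, run/shared/lean/b2b/bsd-rank1-residual/, verbatim in every
file): the goal of the cell is to DELETE the COMBINATION-SHAPED residual classes of the
Birch–Swinnerton-Dyer formula for ALL analytic-rank `≤ 1` elliptic curves over `ℚ` — "full BSD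
formula for every rank `≤ 1` curve in class `C`" assembled STRICTLY from published theorems — so
that the rank-`≤ 1` remainder becomes exactly the CONSTRUCTION-SHAPED classes, which are TYPED
(missing-input `Prop`s), NOT attempted. This is not "finishing BSD". Sub-cell `multr1-p2` is a
RESEARCH ROUTE on class X11b (`ClassX11b W p := r_an = 1 ∧ p ≠ 2 ∧ mult(p) ∧ irr(p)`,
`Partition/Rows.lean`); no claim beyond the stated class and locus; X11b's label does not change.

THEOREMS ONLY (no definition, no named fact). What route p2 settles, HALF BY HALF (the pointwise
halves are `X11b/BDPRouteHalves.lean`; the Heegner data are produced exactly as in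
`X11b/BDPRouteStatement.lean` / `BDPRouteManin.lean`: sign `−1` by modularity, the auxiliary field by
Friedberg–Hoffstein with every `ℓ ∣ N` split and `|d_K| > 4`, the Manin-unit datum by
`exists_maninDatum` — modularity + Mazur 1978 Cor. 4.1 + Néron mapping property —, a globally
minimal model of the twist by Néron–Silverman VIII.8.3, the transports (a)–(e) by `TwistTransport*.lean`,
and the rank-`0` `p`-part of the twist by Skinner 2016 Thm. C):

* `missingUpperBoundAt_of_classX11b_of_locus` — **UNCONDITIONAL** (published named facts only, NO
  typed input): for every `(E,p)` of X11b on the route's `Locus` (`p ≥ 5`, a (ram) prime,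
  `p ∤ ∏_ℓ c_ℓ(E)`), the Euler-system half of `BSD(E,p)`: `ord_p #Ш(E) ≤ ord_p #Ш(E)_an`
  (`Typed.MissingUpperBoundAt`) — Kolyvagin 1990 over `K` (`Kolyvagin1990_padicValNat_card_sha_le`,
  `ρ̄_{E,p}` surjective by `surj_of_irr_of_ram`) + Gross–Zagier + Skinner 2016 Thm. C for the twist.
  Jetchev–Skinner–Wan 2017 §7.4.2 at `p ∥ N` with the classical modular parametrisation.
* `missingLowerBoundAt_of_classX11b_of_ram` — for every `(E,p)` of X11b with `p ≥ 5` and a (ram)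
  prime — NO Tamagawa condition —, STEP L (the route's typed input `IndexLowerBoundAt`, OPEN at
  `p ∥ N`, taken at every Heegner datum with Manin constant prime to `p` of such pairs) ⇒ the
  main-conjecture half `ord_p #Ш(E)_an ≤ ord_p #Ш(E)` (`Typed.MissingLowerBoundAt`).
  Jetchev–Skinner–Wan 2017 §7.4.1 at `p ∥ N`. CONDITIONAL on STEP L.
* `statement_of_indexLowerBoundAt'` — the halves recombine to the sub-cell target of record
  `X11b.Statement` (full `BSD(E,p)` on `Locus`), as in `BDPRouteManin.statement_of_indexLowerBoundAt`.

So, given STEP L, the route yields FULL `BSD(E,p)` on `Locus` and the LOWER-BOUND half on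
X11b ∧ `p ≥ 5` ∧ (ram) with `p ∣ ∏_ℓ c_ℓ(E)` (the cell's atom "(ram, `p ∣ Tam`)": hyp seat
SUBCELL-LEDGER, 80 ‖ 32 CORE-open pairs at `N < 2·10⁴` ‖ `N < 10⁴`, next to `Locus` 47 ‖ 4), where
the missing UPPER half is Kolyvagin's bound sharpened by the Tamagawa numbers — in print only under
`p ∤ N` (Jetchev 2008) or via the Shimura-curve parametrisation `X_{N⁺,N⁻}` with the `p ∣ c_q` primes
in `N⁻` (Jetchev–Skinner–Wan 2017 §7.4.2, Thm. 4.4.1 — objects the tree does not have). Pairs of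
X11b without a (ram) prime get nothing from this route (Skinner 2016 Thm. C (ii) for the twist).
X11b stays CONSTRUCTION-SHAPED; nothing is booked by these theorems.

References: [JetchevSkinnerWan2017] §7.4.1–7.4.2 (pp. 29–31), Thm. 4.4.1, Thm. 7.2.1;
[Skinner2016PacificMC] Thm. C; [KolyvaginEulerSystems1990] Thm. A; [McCallumLMS1991] §1;
[Mazur1978] Cor. 4.1; [FriedbergHoffstein1995]; [Jetchev2008] Cor. 1.5; [Miller2011LMS] Def. 1.1.
-/

noncomputable section

open scoped Classical

open WeierstrassCurve NumberField Literature.NumberTheory.EllipticCurves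
  Literature.NumberTheory.EllipticCurves.ModularForms
  Literature.NumberTheory.EllipticCurves.Rank1Residual

namespace Summit.BirchSwinnertonDyer.Rank1Residual.X11b

/-- **The two halves at a pair of X11b with `p ≥ 5` and a (ram) prime, at fixed Heegner data.**
Data: `W/ℚ` globally minimal of conductor `N`, `ord_{s=1} L(E,s) = 1`, `p ≥ 5` multiplicative with
`E[p]` irreducible and a (ram) prime; `K` imaginary quadratic with the Heegner hypothesis for `N`,
`p ∤ #𝓞_K^×`, `L(E^{d_K},1) ≠ 0`; `P` the Heegner point of a datum `Dt` with `p ∤ c`; `Wd = Cd • W^{(d_K)}`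
a globally minimal model of the twist. PUBLISHED binders: `hGZ`, `hKo`, `hSk` (Skinner 2016 Thm. C,
applied to `Wd`: multiplicative at `p`, irreducible, (ram) — transported from `W` by
`TwistTransport*.lean` —, giving BOTH halves of the twist's rank-`0` `p`-part), `hGZK`, `hmod`.
CONCLUSION: (1) STEP L at `P` ⇒ `Typed.MissingLowerBoundAt W p` (NO Tamagawa condition);
(2) `p ∤ ∏_ℓ c_ℓ(E)` and a bound of Kolyvagin's shape `ord_p #Ш(E/K) ≤ 2·ord_p [E(K):ℤP]` ⇒
`Typed.MissingUpperBoundAt W p`. The transports (d) `ord_p ∏c(Wd) = ord_p ∏c(W)` and (e)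
`ord_p u(Cd) = 0` are the tree theorems `padicValNat_tamagawaProduct_twist_of_heegner`,
`padicValRat_u_eq_zero_of_twist_minimal`. [cite: JetchevSkinnerWan2017, §7.4.1–7.4.2 (pp. 30–31)]
[cite: Skinner2016PacificMC, Thm. C (§1)] [cite: Miller2011LMS, Def. 1.1] -/
theorem halves_of_heegnerData
    (W : WeierstrassCurve ℚ) [W.IsElliptic] [W.IsGloballyMinimal] (p : ℕ) [Fact p.Prime]
    [NeZero (W.conductorNorm ℤ)] (K : Type) [Field K] [NumberField K]
    (Dt : ModularParametrizationData W (W.conductorNorm ℤ))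
    (H : HeegnerDatum (W.conductorNorm ℤ) (NumberField.discr K)) (ι : K →+* ℂ)
    (P : (W.baseChange K).toAffine.Point)
    -- the published inputs (named facts of the tree)
    (hGZ : gross_zagier (W.conductorNorm ℤ) W K) (hKo : kolyvagin (W.conductorNorm ℤ) W K)
    (hSk : Skinner2016.thmC_padicValRat_bsd_rank_zero)
    (hGZK : rank_eq_analyticRank_of_analyticRank_le_one) (hmod : hasEntireLFunction_rat)
    -- the pair
    (hr : W.analyticRank = 1) (hp5 : 5 ≤ p) (hmult : Mult W p) (hirr : Irr W p) (hram : Ram W p)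
    -- the Heegner data
    (hK : IsImaginaryQuadratic K) (hHN : SatisfiesHeegnerHypothesis (W.conductorNorm ℤ) K)
    (hP : WeierstrassCurve.Affine.Point.map ι.toRatAlgHom P = heegnerPointComplex Dt H)
    (hc : ¬ (p : ℤ) ∣ Dt.c) (hμ : ¬ p ∣ Units.torsionOrder K)
    (hLt : (W.quadraticTwist (NumberField.discr K : ℚ)).entireLFunction 1 ≠ 0)
    (Wd : WeierstrassCurve ℚ) [Wd.IsElliptic] [Wd.IsGloballyMinimal] (Cd : VariableChange ℚ)
    (hWd : Cd • W.quadraticTwist (NumberField.discr K : ℚ) = Wd) :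
    (IndexLowerBoundAt W p K P → Typed.MissingLowerBoundAt W p) ∧
      (¬ p ∣ W.tamagawaProduct →
        (Finite (W.baseChange K).sha → ¬ IsOfFinAddOrder P →
          padicValNat p (Nat.card (W.baseChange K).sha) ≤
            2 * padicValNat p (AddSubgroup.zmultiples P).index) →
        Typed.MissingUpperBoundAt W p) := by
  have hp2 : p ≠ 2 := by omega
  have hp3 : 3 ≤ p := by omega
  have hD0 : (NumberField.discr K : ℚ) ≠ 0 := by exact_mod_cast NumberField.discr_ne_zero K
  haveI hEt : (W.quadraticTwist (NumberField.discr K : ℚ)).IsElliptic :=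
    W.isElliptic_quadraticTwist hD0
  -- transports (a)–(e) to the minimal twist model
  have hmultd : Wd.HasMultiplicativeReductionAtPrime p :=
    hasMultiplicativeReductionAtPrime_twist_of_heegner' W p K hK hHN hmult Cd hWd
  have hirrd : Wd.HasIrreducibleModPGaloisRep p :=
    hasIrreducibleModPGaloisRep_twist_model W p K hK.1 hirr Cd hWd
  have hramd : Ram Wd p := ram_twist_of_heegner W p K hK hHN hram Cd hWd
  have htam : padicValNat p Wd.tamagawaProduct = padicValNat p W.tamagawaProduct :=
    padicValNat_tamagawaProduct_twist_of_heegner W p hp5 K hK hHN Cd hWd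
  have hu : padicValRat p (Cd.u : ℚ) = 0 :=
    padicValRat_u_eq_zero_of_twist_minimal W p K hK hHN hmult Cd hWd
  -- the twist: `L(E^D,1) ≠ 0`, finiteness, and Skinner's Thm. C (both halves)
  have hLt' : (W.quadraticTwist (NumberField.discr K : ℚ)).entireLFunction = Wd.entireLFunction := by
    rw [← hWd, entireLFunction_smul]
  have hLd1 : Wd.entireLFunction 1 ≠ 0 := by rw [← hLt']; exact hLt
  have hrd : Wd.analyticRank = 0 := (Wd.analyticRank_eq_zero_iff_holds (hmod Wd)).2 hLd1
  have hfinSd : Finite Wd.sha := (hGZK Wd (by omega)).2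
  obtain ⟨qd, hqd, hvqd⟩ := hSk Wd p hp3 (Or.inr hmultd) hirrd hramd hLd1 hfinSd
  refine ⟨fun hL ↦ ?_, fun htam0 hU ↦ ?_⟩
  · exact missingLowerBoundAt_of_indexLowerBoundAt W p (W.conductorNorm ℤ) K Dt H ι P hGZ hKo hGZK
      hmod hK hHN hP hp2 hc hμ hr hLt Wd Cd hWd hu htam ⟨qd, hqd, hvqd.symm.le⟩ (fun _ ↦ hL)
  · exact missingUpperBoundAt_of_shaIndexBound W p (W.conductorNorm ℤ) K Dt H ι P hGZ hKo hGZK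
      hmod hK hHN hP hp2 hc hμ hr hLt Wd Cd hWd hu htam htam0 ⟨qd, hqd, hvqd.le⟩ hU

/-- **The Euler-system half of `BSD(E,p)` on the route's `Locus` — UNCONDITIONAL (published named
facts only).** For every `(E,p)` in X11b (`r_an = 1`, `p` odd, multiplicative at `p`, `E[p]`
irreducible) with `p ≥ 5`, a (ram) prime and `p ∤ ∏_ℓ c_ℓ(E)`: `ord_p #Ш(E) ≤ ord_p #Ш(E)_an`
(`Typed.MissingUpperBoundAt W p`). Inputs, all PUBLISHED named facts of the tree: Gross–Zagier
(`hGZ`), Kolyvagin 1990 Thm. A (`hKo` qualitative, `hB` the index bound — `ρ̄_{E,p}` surjective by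
`surj_of_irr_of_ram`), Skinner 2016 Thm. C (`hSk`, for the twist), Gross–Zagier–Kolyvagin over `ℚ`
(`hGZK`), modularity (`hmod`, `hnf`), Friedberg–Hoffstein (`hFH`), Mazur 1978 Cor. 4.1 (`hMaz`) and
the Néron mapping property (`hNS`) for the Manin-unit datum (`exists_maninDatum`). This is
Jetchev–Skinner–Wan 2017 §7.4.2 run at `p ∥ N` with the classical parametrisation: the missing
direction of `BSD(E,p)` on `Locus` is EXACTLY STEP L. Nothing is booked; X11b's label unchanged.
[cite: JetchevSkinnerWan2017, §7.4.2 (p. 31)] [cite: McCallumLMS1991, §1 Theorem (Kolyvagin), p. 296]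
[cite: Skinner2016PacificMC, Thm. C (§1)] [cite: Mazur1978, Cor. 4.1] [cite: Miller2011LMS, Def. 1.1] -/
theorem missingUpperBoundAt_of_classX11b_of_locus
    -- published inputs (named facts of the tree)
    (hGZ : ∀ (N : ℕ) [NeZero N] (W : WeierstrassCurve ℚ) (K : Type) [Field K] [NumberField K],
      gross_zagier N W K)
    (hKo : ∀ (N : ℕ) [NeZero N] (W : WeierstrassCurve ℚ) (K : Type) [Field K] [NumberField K],
      kolyvagin N W K)
    (hB : ∀ (N : ℕ) [NeZero N] (W : WeierstrassCurve ℚ) (K : Type) [Field K] [NumberField K],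
      Kolyvagin1990_padicValNat_card_sha_le N W K)
    (hSk : Skinner2016.thmC_padicValRat_bsd_rank_zero)
    (hGZK : rank_eq_analyticRank_of_analyticRank_le_one) (hmod : hasEntireLFunction_rat)
    (hnf : exists_isNewformOf)
    (hFH : friedbergHoffstein_exists_heegnerField_split_twist_ne_zero)
    (hMaz : mazur_not_dvd_maninConstant_of_odd) (hNS : integral_neronScaling_of_isGloballyMinimal) :
    ∀ (W : WeierstrassCurve ℚ) [W.IsElliptic] [W.IsGloballyMinimal] (p : ℕ) [Fact p.Prime],
      ClassX11b W p → Locus W p → Typed.MissingUpperBoundAt W p := by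
  intro W _ _ p _ hX hloc
  have hp : p.Prime := Fact.out
  obtain ⟨hr, -, hmult, hirr⟩ := hX
  obtain ⟨hp5, hram, htam0⟩ := hloc
  have hp2 : p ≠ 2 := by omega
  haveI : NeZero (W.conductorNorm ℤ) := ⟨(W.conductorNorm_pos_holds).ne'⟩
  -- the sign of the functional equation is `−1` (modularity, `r_an = 1`)
  have hw : W.rootNumber = -1 := by
    rw [WeierstrassCurve.rootNumber_eq_neg_one_pow_analyticRank_of_exists_isNewformOf hnf W, hr]
    norm_num
  -- the auxiliary field (Friedberg–Hoffstein): every `ℓ ∣ N` split, `|d_K| > 4`, `L(E^{d_K},1) ≠ 0`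
  obtain ⟨K, _, _, hK, hdisc, hHN, -, hLt⟩ := hFH W hw p hp 4
  -- `w_K = 2`, prime to `p ≥ 5`
  have hμ : ¬ p ∣ Units.torsionOrder K := by
    haveI : IsTotallyComplex K := hK.2
    have hneg : NumberField.discr K < 0 := discr_neg_of_finrank_eq_two K hK.1
    have habs : ((NumberField.discr K).natAbs : ℤ) = -NumberField.discr K :=
      Int.ofNat_natAbs_of_nonpos hneg.le
    have h4 : NumberField.discr K < -4 := by
      have : (4 : ℤ) < ((NumberField.discr K).natAbs : ℤ) := by exact_mod_cast hdisc
      omega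
    rw [Literature.NumberTheory.DiophantineGeometry.torsionOrder_eq_two_of_discr_lt hK.1 h4]
    intro h2
    have := Nat.le_of_dvd two_pos h2
    omega
  -- the Heegner datum with `p ∤ c` (modularity, Mazur 1978 Cor. 4.1, Néron mapping property)
  obtain ⟨Dt, H, ι, P, hP, hc⟩ :=
    exists_maninDatum hnf hMaz hNS W p (W.conductorNorm ℤ) K rfl hp5 hmult hirr hK hHN
  -- a globally minimal model of the twist (Néron; Silverman VIII.8 Cor. 8.3)
  have hD0 : (NumberField.discr K : ℚ) ≠ 0 := by exact_mod_cast NumberField.discr_ne_zero K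
  haveI hEt : (W.quadraticTwist (NumberField.discr K : ℚ)).IsElliptic :=
    W.isElliptic_quadraticTwist hD0
  obtain ⟨Cd, hCd⟩ := hasGlobalMinimalModel_rat_holds (W.quadraticTwist (NumberField.discr K : ℚ))
  haveI : (Cd • W.quadraticTwist (NumberField.discr K : ℚ)).IsGloballyMinimal := hCd
  have hWd : Cd • W.quadraticTwist (NumberField.discr K : ℚ) =
      Cd • W.quadraticTwist (NumberField.discr K : ℚ) := rfl
  -- Kolyvagin's bound (`ρ̄_{E,p}` surjective from irr + ram)
  have hsurj : Surj W p := surj_of_irr_of_ram W p hirr hram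
  have hU : Finite (W.baseChange K).sha → ¬ IsOfFinAddOrder P →
      padicValNat p (Nat.card (W.baseChange K).sha) ≤
        2 * padicValNat p (AddSubgroup.zmultiples P).index :=
    fun _ hnt ↦ hB _ W K hK hHN ⟨Dt, H, ι, hP⟩ hnt hp hp2 hsurj
  exact (halves_of_heegnerData W p K Dt H ι P (hGZ _ W K) (hKo _ W K) hSk hGZK hmod hr hp5 hmult
    hirr hram hK hHN hP hc hμ hLt (Cd • W.quadraticTwist (NumberField.discr K : ℚ)) Cd hWd).2
    htam0 hU

/-- **The main-conjecture half of `BSD(E,p)` from STEP L on X11b ∧ `p ≥ 5` ∧ (ram) — NO Tamagawa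
condition.** For every `(E,p)` in X11b with `p ≥ 5` and a (ram) prime: STEP L (`hL`: the route's
typed input `IndexLowerBoundAt`, OPEN at `p ∥ N` — `X11b/BDPRoute.lean` —, at every Heegner datum
of such a pair with Manin constant prime to `p`) and the PUBLISHED named facts `hGZ`, `hKo`, `hSk`
(Skinner 2016 Thm. C, the twist's rank-`0` `p`-part), `hGZK`, `hmod`, `hnf`, `hFH`, `hMaz`, `hNS`
imply `ord_p #Ш(E)_an ≤ ord_p #Ш(E)` (`Typed.MissingLowerBoundAt W p`). Jetchev–Skinner–Wan 2017
§7.4.1 run at `p ∥ N`: the Tamagawa term of STEP L is exactly the Tamagawa term of BSD over `K`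
(`ord_p ∏_w c_w(E/K) = 2·ord_p ∏_ℓ c_ℓ(E)` for a field in which every `ℓ ∣ N` splits), so — unlike
Kolyvagin's half — this half needs no condition on `∏_ℓ c_ℓ(E)`. CONDITIONAL on STEP L; nothing is
booked; X11b stays CONSTRUCTION-SHAPED. [cite: JetchevSkinnerWan2017, §7.4.1 (pp. 30–31)]
[cite: Skinner2016PacificMC, Thm. C (§1)] [cite: Mazur1978, Cor. 4.1] [cite: Miller2011LMS, Def. 1.1] -/
theorem missingLowerBoundAt_of_classX11b_of_ram
    -- published inputs (named facts of the tree)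
    (hGZ : ∀ (N : ℕ) [NeZero N] (W : WeierstrassCurve ℚ) (K : Type) [Field K] [NumberField K],
      gross_zagier N W K)
    (hKo : ∀ (N : ℕ) [NeZero N] (W : WeierstrassCurve ℚ) (K : Type) [Field K] [NumberField K],
      kolyvagin N W K)
    (hSk : Skinner2016.thmC_padicValRat_bsd_rank_zero)
    (hGZK : rank_eq_analyticRank_of_analyticRank_le_one) (hmod : hasEntireLFunction_rat)
    (hnf : exists_isNewformOf)
    (hFH : friedbergHoffstein_exists_heegnerField_split_twist_ne_zero)
    (hMaz : mazur_not_dvd_maninConstant_of_odd) (hNS : integral_neronScaling_of_isGloballyMinimal)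
    -- the typed input of the route (STEP L), at every Heegner datum with Manin constant prime to `p`
    (hL : ∀ (W : WeierstrassCurve ℚ) [W.IsElliptic] [W.IsGloballyMinimal] (p : ℕ) [Fact p.Prime]
      (N : ℕ) [NeZero N] (K : Type) [Field K] [NumberField K]
      (Dt : ModularParametrizationData W N) (H : HeegnerDatum N (NumberField.discr K)) (ι : K →+* ℂ)
      (P : (W.baseChange K).toAffine.Point),
      ClassX11b W p → 5 ≤ p → Ram W p → W.conductorNorm ℤ = N → IsImaginaryQuadratic K →
      SatisfiesHeegnerHypothesis N K →
      WeierstrassCurve.Affine.Point.map ι.toRatAlgHom P = heegnerPointComplex Dt H →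
      ¬ (p : ℤ) ∣ Dt.c → IndexLowerBoundAt W p K P) :
    ∀ (W : WeierstrassCurve ℚ) [W.IsElliptic] [W.IsGloballyMinimal] (p : ℕ) [Fact p.Prime],
      ClassX11b W p → 5 ≤ p → Ram W p → Typed.MissingLowerBoundAt W p := by
  intro W _ _ p _ hX hp5 hram
  have hp : p.Prime := Fact.out
  have hX' := hX
  obtain ⟨hr, -, hmult, hirr⟩ := hX
  haveI : NeZero (W.conductorNorm ℤ) := ⟨(W.conductorNorm_pos_holds).ne'⟩
  -- the sign of the functional equation is `−1` (modularity, `r_an = 1`)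
  have hw : W.rootNumber = -1 := by
    rw [WeierstrassCurve.rootNumber_eq_neg_one_pow_analyticRank_of_exists_isNewformOf hnf W, hr]
    norm_num
  -- the auxiliary field (Friedberg–Hoffstein): every `ℓ ∣ N` split, `|d_K| > 4`, `L(E^{d_K},1) ≠ 0`
  obtain ⟨K, _, _, hK, hdisc, hHN, -, hLt⟩ := hFH W hw p hp 4
  -- `w_K = 2`, prime to `p ≥ 5`
  have hμ : ¬ p ∣ Units.torsionOrder K := by
    haveI : IsTotallyComplex K := hK.2
    have hneg : NumberField.discr K < 0 := discr_neg_of_finrank_eq_two K hK.1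
    have habs : ((NumberField.discr K).natAbs : ℤ) = -NumberField.discr K :=
      Int.ofNat_natAbs_of_nonpos hneg.le
    have h4 : NumberField.discr K < -4 := by
      have : (4 : ℤ) < ((NumberField.discr K).natAbs : ℤ) := by exact_mod_cast hdisc
      omega
    rw [Literature.NumberTheory.DiophantineGeometry.torsionOrder_eq_two_of_discr_lt hK.1 h4]
    intro h2
    have := Nat.le_of_dvd two_pos h2
    omega
  -- the Heegner datum with `p ∤ c` (modularity, Mazur 1978 Cor. 4.1, Néron mapping property)
  obtain ⟨Dt, H, ι, P, hP, hc⟩ :=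
    exists_maninDatum hnf hMaz hNS W p (W.conductorNorm ℤ) K rfl hp5 hmult hirr hK hHN
  -- a globally minimal model of the twist (Néron; Silverman VIII.8 Cor. 8.3)
  have hD0 : (NumberField.discr K : ℚ) ≠ 0 := by exact_mod_cast NumberField.discr_ne_zero K
  haveI hEt : (W.quadraticTwist (NumberField.discr K : ℚ)).IsElliptic :=
    W.isElliptic_quadraticTwist hD0
  obtain ⟨Cd, hCd⟩ := hasGlobalMinimalModel_rat_holds (W.quadraticTwist (NumberField.discr K : ℚ))
  haveI : (Cd • W.quadraticTwist (NumberField.discr K : ℚ)).IsGloballyMinimal := hCd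
  have hWd : Cd • W.quadraticTwist (NumberField.discr K : ℚ) =
      Cd • W.quadraticTwist (NumberField.discr K : ℚ) := rfl
  exact (halves_of_heegnerData W p K Dt H ι P (hGZ _ W K) (hKo _ W K) hSk hGZK hmod hr hp5 hmult
    hirr hram hK hHN hP hc hμ hLt (Cd • W.quadraticTwist (NumberField.discr K : ℚ)) Cd hWd).1
    (hL W p _ K Dt H ι P hX' hp5 hram rfl hK hHN hP hc)

/-- **The halves recombine to the sub-cell target of record `X11b.Statement`** (full `BSD(E,p)` on
`Locus`, as in `BDPRouteManin.statement_of_indexLowerBoundAt`): upper half UNCONDITIONAL on `Locus`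
(`missingUpperBoundAt_of_classX11b_of_locus`), lower half from STEP L on X11b ∧ `p ≥ 5` ∧ (ram)
(`missingLowerBoundAt_of_classX11b_of_ram`), and `bsdp_of_halves`. CONDITIONAL on STEP L (here
assumed at the Manin-good Heegner data of every X11b pair with `p ≥ 5` and a (ram) prime — the
natural domain of the lower half; the `Locus` pairs are among them). X11b stays CONSTRUCTION-SHAPED.
[cite: JetchevSkinnerWan2017, §7.4.1–7.4.3 (pp. 30–31)] [cite: Miller2011LMS, Def. 1.1] -/
theorem statement_of_indexLowerBoundAt'
    -- published inputs (named facts of the tree)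
    (hGZ : ∀ (N : ℕ) [NeZero N] (W : WeierstrassCurve ℚ) (K : Type) [Field K] [NumberField K],
      gross_zagier N W K)
    (hKo : ∀ (N : ℕ) [NeZero N] (W : WeierstrassCurve ℚ) (K : Type) [Field K] [NumberField K],
      kolyvagin N W K)
    (hB : ∀ (N : ℕ) [NeZero N] (W : WeierstrassCurve ℚ) (K : Type) [Field K] [NumberField K],
      Kolyvagin1990_padicValNat_card_sha_le N W K)
    (hSk : Skinner2016.thmC_padicValRat_bsd_rank_zero)
    (hGZK : rank_eq_analyticRank_of_analyticRank_le_one) (hmod : hasEntireLFunction_rat)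
    (hnf : exists_isNewformOf)
    (hFH : friedbergHoffstein_exists_heegnerField_split_twist_ne_zero)
    (hMaz : mazur_not_dvd_maninConstant_of_odd) (hNS : integral_neronScaling_of_isGloballyMinimal)
    -- the typed input of the route (STEP L), at every Heegner datum with Manin constant prime to `p`
    (hL : ∀ (W : WeierstrassCurve ℚ) [W.IsElliptic] [W.IsGloballyMinimal] (p : ℕ) [Fact p.Prime]
      (N : ℕ) [NeZero N] (K : Type) [Field K] [NumberField K]
      (Dt : ModularParametrizationData W N) (H : HeegnerDatum N (NumberField.discr K)) (ι : K →+* ℂ)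
      (P : (W.baseChange K).toAffine.Point),
      ClassX11b W p → 5 ≤ p → Ram W p → W.conductorNorm ℤ = N → IsImaginaryQuadratic K →
      SatisfiesHeegnerHypothesis N K →
      WeierstrassCurve.Affine.Point.map ι.toRatAlgHom P = heegnerPointComplex Dt H →
      ¬ (p : ℤ) ∣ Dt.c → IndexLowerBoundAt W p K P) :
    Statement := by
  intro W _ _ p _ hX hloc
  exact bsdp_of_halves hGZK W p (le_of_eq hX.1)
    (missingLowerBoundAt_of_classX11b_of_ram hGZ hKo hSk hGZK hmod hnf hFH hMaz hNS hL W p hX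
      hloc.1 hloc.2.1)
    (missingUpperBoundAt_of_classX11b_of_locus hGZ hKo hB hSk hGZK hmod hnf hFH hMaz hNS W p hX hloc)

end Summit.BirchSwinnertonDyer.Rank1Residual.X11b

end
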